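import Summits.Schanuel.Schanuel.Theorems.SoloInformedClusterStructuredRoots
import Summits.Schanuel.Schanuel.Theorems.SoloInformedStructuredNonConjugate

/-!
# Theorem AE₃♯-1, middle: from the structured roots at full depth to a Gel'fond input

Soloist file (informed mode, seat `solo-Schanuel-informed`, s184).  The verbatim analogue of
`SoloInformedAE3GelfondInput` (THEOREM AE₃-1, `paper/AE-note.md` §14) on top of the full-depth
structured-roots theorem `soloCS_structured_roots` (`SoloInformedClusterStructuredRoots`, work
note `work/s184/CLUSTER-note.md`), on the node `RoyAdditiveDirichletExponent`
([cite: Roy2010, Thm 1.1]): a polynomial `P ∈ RoyAdditiveSmall ξ β σ τ ν n` has `≥ (49/100) K`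
roots `γ + s μ` (`s ∈ S' ⊆ [1, K]`, `μ ≠ 0`) within `exp(-W)`, `W = n^ν K / (800000 n)`, of
the points `s ξ`; by `soloNC_exists_cheap_factor_on_progression` (Lemma H + pigeonhole) one of
them lies on an irreducible factor `q ∣ P` with `deg q ≤ 20 n / K` and
`log M(q) ≤ 40 n^β / K`; and by `soloDF_package` the dilated polynomial `Q = q(sT) ∈ ℤ[X]` is
non-zero with `deg Q ≤ 20 n / K`, Gel'fond type `≤ (20 n / K)(2 + log K) + 40 n^β / K` and
`‖Q(ξ)‖ ≤ exp(-W/2)` (given the explicit inequality `h₆`).  The only change from the AE₃-1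
version is the budget hypothesis: `8·10⁶ n² n^β ≤ K² n^ν` instead of
`2.88·10¹¹ n³ n^β ≤ K³ n^ν`.

What this is NOT.  Not yet THEOREM AE₃♯-1 (the asymptotics are the last file), and nothing here
bears on `Literature.Periods.SchanuelConjecture` (the seat's verdict, no path, is unchanged);
the node [cite: Roy2010, Thm 1.1] is not claimed.  Tree files and Mathlib only; no
definitions, no literature hypothesis; axioms the standard three.
-/

namespace Summit.Schanuel.Schanuel.Theorems

open Polynomial Finset

/-- **Gel'fond input from Roy's additive data at full depth.**  Under the hypotheses of
`soloCS_structured_roots` and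
`h₆ : (20 n / K) log (K‖ξ‖ + 1) + 40 n^β / K ≤ W / 2` (`W = n^ν K / (800000 n)`), there is a
non-zero `Q ∈ ℤ[X]` with `deg Q ≤ 20 n / K`,
`t(Q) ≤ (20 n / K)(2 + log K) + 40 n^β / K` and `‖Q(ξ)‖ ≤ exp(-W/2)`. -/
theorem soloCG_gelfond_input {ξ : ℂ} (hξ : Transcendental ℚ ξ) {β σ τ ν : ℝ} (hβ : 1 ≤ β)
    {n K : ℕ} (hn : 1 ≤ n) (hK : 2000 ≤ K) (hKσ : (K : ℝ) ≤ (n : ℝ) ^ σ) {c₁ : ℝ}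
    (hc : Real.exp (-c₁) ≤ min 1 (‖ξ‖ / 2)) (h₁ : 2 * c₁ * n ≤ (n : ℝ) ^ ν)
    (h₄ : Real.log 4 ≤ (n : ℝ) ^ ν * K / (1600000 * n))
    (h₅ : 8000000 * ((n : ℝ) ^ 2 * (n : ℝ) ^ β) ≤ (K : ℝ) ^ 2 * (n : ℝ) ^ ν)
    (h₆ : 20 * n / K * Real.log (K * ‖ξ‖ + 1) + 40 * (n : ℝ) ^ β / K ≤
      (n : ℝ) ^ ν * K / (1600000 * n))
    {P : ℤ[X]} (hP : P ∈ RoyAdditiveSmall ξ β σ τ ν n) :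
    ∃ Q : ℤ[X], Q ≠ 0 ∧ (Q.natDegree : ℝ) ≤ 20 * n / K ∧
      Q.gelfondType ≤ 20 * n / K * (2 + Real.log K) + 40 * (n : ℝ) ^ β / K ∧
      ‖aeval ξ Q‖ ≤ Real.exp (-((n : ℝ) ^ ν * K / (1600000 * n))) := by
  obtain ⟨S', hS'sub, hS'card, γ, μ, hμ, hroots⟩ :=
    soloCS_structured_roots hξ hβ hn hK hKσ hc h₁ h₄ h₅ hP
  obtain ⟨hP0, hdeg, hht, -⟩ := hP
  have hn0 : (0 : ℝ) < n := by exact_mod_cast hn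
  have hK0 : (0 : ℝ) < K := by exact_mod_cast (show 0 < K by omega)
  have hK1 : (1 : ℝ) ≤ K := by exact_mod_cast (show 1 ≤ K by omega)
  set W : ℝ := (n : ℝ) ^ ν * K / (800000 * n) with hW
  have hW2 : (n : ℝ) ^ ν * K / (1600000 * n) = W / 2 := by rw [hW]; ring
  -- a cheap irreducible factor through one of the structured roots
  have hd₀ : (0 : ℝ) < 20 * n / K := by positivity
  have hβ0 : (0 : ℝ) < (n : ℝ) ^ β := Real.rpow_pos_of_pos hn0 β
  have hh₀ : (0 : ℝ) < 40 * (n : ℝ) ^ β / K := by positivity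
  obtain ⟨hlogM0, hlogM⟩ := soloSR_log_mahlerMeasure_le hP0 hn hdeg hβ hht
  have hbudget : 2 * (P.natDegree / (20 * n / K) +
      Real.log (P.map (Int.castRingHom ℂ)).mahlerMeasure / (40 * (n : ℝ) ^ β / K)) < #S' := by
    have hd : (P.natDegree : ℝ) / (20 * n / K) ≤ K / 20 := by
      rw [div_le_iff₀ hd₀]
      have : (P.natDegree : ℝ) ≤ n := by exact_mod_cast hdeg
      calc (P.natDegree : ℝ) ≤ n := this
        _ = K / 20 * (20 * n / K) := by field_simp
    have hh : Real.log (P.map (Int.castRingHom ℂ)).mahlerMeasure / (40 * (n : ℝ) ^ β / K) ≤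
        K / 20 := by
      rw [div_le_iff₀ hh₀]
      calc Real.log (P.map (Int.castRingHom ℂ)).mahlerMeasure ≤ 2 * (n : ℝ) ^ β := hlogM
        _ = K / 20 * (40 * (n : ℝ) ^ β / K) := by field_simp; ring
    linarith
  obtain ⟨s, hs, q, hqirr, hqdeg, -, hqval, hqd, hqh⟩ :=
    soloNC_exists_cheap_factor_on_progression P hP0 γ μ hμ S' (fun s hs => (hroots s hs).1)
      hd₀ hh₀ hbudget
  have hq0 : q ≠ 0 := hqirr.ne_zero
  have hs1 : 1 ≤ s := (Finset.mem_Icc.mp (hS'sub hs)).1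
  have hsK : s ≤ K := (Finset.mem_Icc.mp (hS'sub hs)).2
  -- the dilated factor `q(sT)`
  obtain ⟨Q, hQ0, hQdeg, hQtype, -, hQval⟩ :=
    soloDF_package hξ q hq0 hqval hs1 hsK (Real.exp_pos _).le (hroots s hs).2
  refine ⟨Q, hQ0, ?_, ?_, ?_⟩
  · rw [hQdeg]; exact hqd
  · have hlogK : 0 ≤ 2 + Real.log K := by linarith [Real.log_nonneg hK1]
    calc Q.gelfondType ≤ q.natDegree * (2 + Real.log K) +
          Real.log (q.map (Int.castRingHom ℂ)).mahlerMeasure := hQtype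
      _ ≤ 20 * n / K * (2 + Real.log K) + 40 * (n : ℝ) ^ β / K :=
          add_le_add (mul_le_mul_of_nonneg_right hqd hlogK) hqh
  · have hM0 : 0 < (q.map (Int.castRingHom ℂ)).mahlerMeasure :=
      zero_lt_one.trans_le (Polynomial.one_le_mahlerMeasure_of_ne_zero hq0)
    have hB0 : 0 < (K : ℝ) * ‖ξ‖ + 1 := by positivity
    have hL0 : 0 ≤ Real.log ((K : ℝ) * ‖ξ‖ + 1) :=
      Real.log_nonneg (by nlinarith [norm_nonneg ξ])
    have hrew : Real.exp (-W) * ((K : ℝ) * ‖ξ‖ + 1) ^ q.natDegree *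
        (q.map (Int.castRingHom ℂ)).mahlerMeasure =
        Real.exp (-W + q.natDegree * Real.log ((K : ℝ) * ‖ξ‖ + 1) +
          Real.log (q.map (Int.castRingHom ℂ)).mahlerMeasure) := by
      rw [Real.exp_add, Real.exp_add, Real.exp_nat_mul, Real.exp_log hB0, Real.exp_log hM0]
    refine hQval.trans ?_
    rw [hrew, hW2, Real.exp_le_exp]
    have h7 : (q.natDegree : ℝ) * Real.log ((K : ℝ) * ‖ξ‖ + 1) ≤
        20 * n / K * Real.log ((K : ℝ) * ‖ξ‖ + 1) := mul_le_mul_of_nonneg_right hqd hL0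
    linarith

end Summit.Schanuel.Schanuel.Theorems
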